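import Mathlib
import HarnessLib
import Literature.MathematicalPhysics.QuantumLattice.GaugeGroups
import Summits.Ventures.LatticeQCDFlow.Exactness.SUNGeneratorSum
import Summits.Ventures.LatticeQCDFlow.Exactness.HaarSteinSpecialUnitary

/-!
# `⟨R_l⟩ = 0`: the engine's closed-form Schwinger–Dyson residual has mean zero under the SU(N) link law

HONEST FRAMING: exact (Metropolis-corrected) sampling algorithms for lattice gauge theory;
figures of merit are autocorrelation/cost numbers at stated couplings and volumes; no
continuum-physics claim.

Venture `LatticeQCDFlow` (cell pub-lqcd), topic `Exactness`, FANOUT row 9 (eng-latcore).  NEW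
WORK of the cell over Mathlib; nothing is cited as a fact.  Printed counterparts, named only: the
lattice Schwinger–Dyson / Migdal–Makeenko equations.

This is the population statement behind `latflow.core.schwinger_dyson.residual_links` (0.2.4+,
release of record 0.2.6), the reference-free exactness observable read on every chain (acceptance
A11, `tools/sd_check.py`, scorer docket L2-A15).  The engine's docstring, verbatim:
`R_l := C_F tr A_l + (beta / 4N) [ tr(A_l A_l) - tr(A_l^† A_l) - (2i/N) (Im tr A_l) (tr A_l) ],
< R_l > = 0 EXACTLY (SU(N))`, with `A_l = U_l R_l` (`R_l` the staple sum closing the plaquettes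
through `l`, so that the `U_l`-dependent Gibbs factor is `e^{(β/N) Re tr A_l}`), `C_F = (N²−1)/(2N)`.
Here it is a THEOREM for one link with the rest of the lattice frozen (the staple sum is an
arbitrary fixed matrix `R`; the lattice statement follows by `FibreLift.lean`'s conditioning):

  `∫_{SU(N)} R(U R_staple) · e^{(β/N) Re tr (U R_staple)} dHaar(U) = 0`   (`schwingerDyson_residual`).

Assembly: `HaarSteinSpecialUnitary.lean` gives the one-generator identity along `exp(tZ)` for
every skew-Hermitian traceless `Z` (real-valued, source `B`); two sources `B = R Z` and
`B = −i R Z` combine into the complex identity `∫ [tr (Z Z A) + c Re tr (Z A) · tr (Z A)] e = 0`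
(`specialUnitary_schwingerDyson_complex`); the weighted family sum of `SUNGeneratorSum.lean`
(`genSum_trace_sq_mul`: `Σ Z Z = −C_F`, `genSum_trace_mul_trace`: Fierz) turns the summed
integrand into `−R(A) · e` pointwise (`genSum_sd_integrand`), and `Σ 0 = 0`.

## Content

* `sdResidual β N A = C_F tr A + (β/(4N)) [tr (A A) − tr (Aᴴ A) − (2i/N) Im tr A · tr A]` — the
  engine's `_per_link_from_A`, symbol for symbol.
* `integrable_of_continuous_SU` — continuous functions on `SU(n)` are Haar-integrable.
* `specialUnitary_schwingerDyson_complex` — the complex one-generator identity.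
* `integral_genSum` — the family sum commutes with the integral.
* `genSum_sd_integrand` — the pointwise closed form of the summed integrand.
* **`schwingerDyson_residual`** — `∫ sdResidual β N (U R) · e^{(β/N) Re tr (U R)} dμ_SU(U) = 0`
  for every `β : ℝ`, every `R`, every `N = card n ≥ 1`.

Not here: the lattice sum over links / plaquette weights (linear bookkeeping over this one-link
statement), U(1) and CP(N−1) columns (`SteinCircle.lean`, `Phi4SiteLaw.lean`), statistical power.
-/

namespace Summit.Ventures.LatticeQCDFlow.Exactness

open Matrix MeasureTheory Complex
open scoped ComplexConjugate

variable {n : Type*} [Fintype n] [DecidableEq n]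

/-! ## §1 The residual and integrability on `SU(n)` -/

/-- The engine's per-link Schwinger–Dyson residual as a function of `A = U_l R_l`:
`R(A) = C_F tr A + (β/(4N)) [tr (A A) − tr (Aᴴ A) − (2i/N) (Im tr A) (tr A)]`. -/
noncomputable def sdResidual (β : ℝ) (N : ℕ) (A : Matrix n n ℂ) : ℂ :=
  casimirF N * A.trace
    + (β / (4 * N) : ℂ) * ((A * A).trace - (Aᴴ * A).trace - (2 * I / N) * ((A.trace).im : ℂ) * A.trace)

omit [DecidableEq n] in
/-- Continuous functions on the compact group `SU(n)` are integrable for its Haar probability. -/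
theorem integrable_of_continuous_SU [DecidableEq n] {f : Matrix.specialUnitaryGroup n ℂ → ℂ}
    (hf : Continuous f) :
    Integrable f (Literature.MathematicalPhysics.QuantumFieldTheory.haarProbability
      (Matrix.specialUnitaryGroup n ℂ)) :=
  hf.integrable_of_hasCompactSupport (HasCompactSupport.of_compactSpace f)

/-- `genSum` with the constant on the right. -/
theorem genSum_mul_const (F : Matrix n n ℂ → ℂ) (c : ℂ) :
    genSum (fun Z => F Z * c) = genSum F * c := by
  have h : (fun Z => F Z * c) = fun Z => c * F Z := funext fun Z => mul_comm _ _
  rw [h, genSum_const_mul, mul_comm]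

/-- The family sum commutes with the integral (finitely many integrable terms). -/
theorem integral_genSum {X : Type*} [MeasurableSpace X] (μ : Measure X)
    (F : Matrix n n ℂ → X → ℂ) (hF : ∀ Z, Integrable (F Z) μ) :
    ∫ x, genSum (fun Z => F Z x) ∂μ = genSum (fun Z => ∫ x, F Z x ∂μ) := by
  unfold genSum
  have h1 : ∀ i j : n, Integrable (fun x => (1 / 8 : ℂ) * (F (genX i j) x + F (genY i j) x)) μ :=
    fun i j => ((hF _).add (hF _)).const_mul _
  have h2 : ∀ i j : n, Integrable (fun x => (1 / (4 * Fintype.card n) : ℂ) * F (genD i j) x) μ :=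
    fun i j => (hF _).const_mul _
  rw [integral_add (integrable_finsetSum _ fun i _ => integrable_finsetSum _ fun j _ => h1 i j)
    (integrable_finsetSum _ fun i _ => integrable_finsetSum _ fun j _ => h2 i j)]
  congr 1
  · rw [integral_finsetSum _ fun i _ => integrable_finsetSum _ fun j _ => h1 i j]
    refine Finset.sum_congr rfl fun i _ => ?_
    rw [integral_finsetSum _ fun j _ => h1 i j]
    refine Finset.sum_congr rfl fun j _ => ?_
    rw [integral_const_mul, integral_add (hF _) (hF _)]
  · rw [integral_finsetSum _ fun i _ => integrable_finsetSum _ fun j _ => h2 i j]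
    refine Finset.sum_congr rfl fun i _ => ?_
    rw [integral_finsetSum _ fun j _ => h2 i j]
    refine Finset.sum_congr rfl fun j _ => ?_
    rw [integral_const_mul]

/-! ## §2 The complex one-generator identity -/

/-- **Complex one-generator Schwinger–Dyson identity on `SU(n)`.**  For skew-Hermitian traceless `Z`,
real `c` and any `R`, with `A = U R`:
`∫ [tr (Z Z A) + c · Re tr (Z A) · tr (Z A)] e^{c Re tr A} dμ_SU(U) = 0` — the sources `B = R Z`
and `B = −i R Z` of `specialUnitary_schwingerDyson` combined as real and imaginary parts. -/
theorem specialUnitary_schwingerDyson_complex (c : ℝ) (R Z : Matrix n n ℂ) (hZ : Zᴴ = -Z)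
    (hZ0 : Z.trace = 0) :
    ∫ U, ((Z * Z * ((U : Matrix n n ℂ) * R)).trace
          + (c : ℂ) * ((((Z * ((U : Matrix n n ℂ) * R)).trace).re : ℝ) : ℂ)
            * (Z * ((U : Matrix n n ℂ) * R)).trace)
        * ((Real.exp (c * (((U : Matrix n n ℂ) * R).trace).re) : ℝ) : ℂ)
      ∂(Literature.MathematicalPhysics.QuantumFieldTheory.haarProbability
          (Matrix.specialUnitaryGroup n ℂ)) = 0 := by
  have h1 := specialUnitary_schwingerDyson c R (R * Z) Z hZ hZ0
  have h2 := specialUnitary_schwingerDyson c R ((-I) • (R * Z)) Z hZ hZ0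
  have hA : Continuous fun U : Matrix.specialUnitaryGroup n ℂ => (U : Matrix n n ℂ) * R :=
    continuous_subtype_val.matrix_mul continuous_const
  -- the two real integrands are continuous, hence integrable after coercion to `ℂ`
  have hcont : ∀ B : Matrix n n ℂ, Continuous fun U : Matrix.specialUnitaryGroup n ℂ =>
      (((((Z * (U : Matrix n n ℂ) * B).trace).re
        + c * (((U : Matrix n n ℂ) * B).trace).re * ((Z * (U : Matrix n n ℂ) * R).trace).re)
        * Real.exp (c * (((U : Matrix n n ℂ) * R).trace).re) : ℝ) : ℂ) := by
    intro B
    refine continuous_ofReal.comp (Continuous.mul (Continuous.add ?_ (Continuous.mul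
      (continuous_const.mul ?_) ?_)) (Real.continuous_exp.comp (continuous_const.mul
      (continuous_re.comp hA.matrix_trace))))
    · exact continuous_re.comp
        ((continuous_const.matrix_mul continuous_subtype_val).matrix_mul continuous_const).matrix_trace
    · exact continuous_re.comp (continuous_subtype_val.matrix_mul continuous_const).matrix_trace
    · exact continuous_re.comp
        ((continuous_const.matrix_mul continuous_subtype_val).matrix_mul continuous_const).matrix_trace
  have key : ((∫ U, (((Z * (U : Matrix n n ℂ) * (R * Z)).trace).re
        + c * (((U : Matrix n n ℂ) * (R * Z)).trace).re * ((Z * (U : Matrix n n ℂ) * R).trace).re)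
        * Real.exp (c * (((U : Matrix n n ℂ) * R).trace).re)
      ∂(Literature.MathematicalPhysics.QuantumFieldTheory.haarProbability
          (Matrix.specialUnitaryGroup n ℂ)) : ℝ) : ℂ)
      + I * ((∫ U, (((Z * (U : Matrix n n ℂ) * ((-I) • (R * Z))).trace).re
        + c * (((U : Matrix n n ℂ) * ((-I) • (R * Z))).trace).re
          * ((Z * (U : Matrix n n ℂ) * R).trace).re)
        * Real.exp (c * (((U : Matrix n n ℂ) * R).trace).re)
      ∂(Literature.MathematicalPhysics.QuantumFieldTheory.haarProbability
          (Matrix.specialUnitaryGroup n ℂ)) : ℝ) : ℂ) = 0 := by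
    rw [h1, h2]; simp
  rw [← integral_complex_ofReal, ← integral_complex_ofReal, ← integral_const_mul,
    ← integral_add (integrable_of_continuous_SU (hcont _))
      ((integrable_of_continuous_SU (hcont _)).const_mul I)] at key
  refine (integral_congr_ae (Filter.Eventually.of_forall fun U => ?_)).trans key
  -- pointwise: the complex integrand is `f₁ + i f₂`
  set V : Matrix n n ℂ := (U : Matrix n n ℂ)
  have hw : (Z * V * (R * Z)).trace = (Z * Z * (V * R)).trace := by
    rw [← Matrix.mul_assoc, Matrix.trace_mul_comm]
    simp only [Matrix.mul_assoc]
  have hw' : (Z * V * ((-I) • (R * Z))).trace = (-I) * (Z * Z * (V * R)).trace := by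
    rw [Matrix.mul_smul, Matrix.trace_smul, smul_eq_mul, hw]
  have hv : (V * (R * Z)).trace = (Z * (V * R)).trace := by
    rw [← Matrix.mul_assoc, Matrix.trace_mul_comm]
  have hv' : (V * ((-I) • (R * Z))).trace = (-I) * (Z * (V * R)).trace := by
    rw [Matrix.mul_smul, Matrix.trace_smul, smul_eq_mul, hv]
  have hv2 : (Z * V * R).trace = (Z * (V * R)).trace := by rw [Matrix.mul_assoc]
  rw [hw, hw', hv, hv', hv2]
  set w : ℂ := (Z * Z * (V * R)).trace
  set v : ℂ := (Z * (V * R)).trace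
  set e : ℝ := Real.exp (c * ((V * R).trace).re)
  apply Complex.ext <;>
    simp only [Complex.add_re, Complex.add_im, Complex.mul_re, Complex.mul_im, Complex.ofReal_re,
      Complex.ofReal_im, Complex.I_re, Complex.I_im, Complex.neg_re, Complex.neg_im] <;> ring

/-! ## §3 The pointwise closed form of the summed integrand -/

/-- **The generator sum of the one-generator integrand is `−R(A)`:**
`genSum (Z ↦ tr (Z Z A) + c Re tr (Z A) tr (Z A)) = −(C_F tr A + (c/4)[tr(AA) − tr(AᴴA) − (2i/N) Im tr A tr A])`. -/
theorem genSum_sd_integrand [Nonempty n] (c : ℝ) (A : Matrix n n ℂ) :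
    genSum (fun Z => (Z * Z * A).trace + (c : ℂ) * ((((Z * A).trace).re : ℝ) : ℂ) * (Z * A).trace)
      = -(casimirF (Fintype.card n) * A.trace
          + (c / 4 : ℂ) * ((A * A).trace - (Aᴴ * A).trace
              - (2 * I / Fintype.card n) * ((A.trace).im : ℂ) * A.trace)) := by
  have hN : (Fintype.card n : ℂ) ≠ 0 := Nat.cast_ne_zero.mpr Fintype.card_ne_zero
  rw [genSum_add, genSum_trace_sq_mul]
  have h2 : genSum (fun Z => (c : ℂ) * ((((Z * A).trace).re : ℝ) : ℂ) * (Z * A).trace)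
      = (c : ℂ) * ((1 / 2 : ℂ) * genSum (fun Z => (Z * A).trace * (Z * A).trace)
          - (1 / 2 : ℂ) * genSum (fun Z => (Z * Aᴴ).trace * (Z * A).trace)) := by
    rw [← genSum_const_mul, ← genSum_const_mul, ← genSum_sub, ← genSum_const_mul]
    refine genSum_congr fun Z hZ _ => ?_
    rw [re_trace_skew_mul hZ]
    ring
  rw [h2, genSum_trace_mul_trace, genSum_trace_mul_trace, Matrix.trace_conjTranspose,
    Complex.star_def]
  have hsub : A.trace - conj A.trace = ((2 * (A.trace).im : ℝ) : ℂ) * I := Complex.sub_conj _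
  push_cast at hsub
  linear_combination ((c : ℂ) / (4 * Fintype.card n) * A.trace) * hsub

/-! ## §4 `⟨R_l⟩ = 0` -/

/-- **The engine's Schwinger–Dyson residual has mean zero under the SU(N) link law.**  For every
`β : ℝ`, every staple matrix `R` and `N = card n ≥ 1`:
`∫ sdResidual β N (U R) · e^{(β/N) Re tr (U R)} dμ_SU(U) = 0`. -/
theorem schwingerDyson_residual [Nonempty n] (β : ℝ) (R : Matrix n n ℂ) :
    ∫ U, sdResidual β (Fintype.card n) ((U : Matrix n n ℂ) * R)
        * ((Real.exp (β / Fintype.card n * (((U : Matrix n n ℂ) * R).trace).re) : ℝ) : ℂ)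
      ∂(Literature.MathematicalPhysics.QuantumFieldTheory.haarProbability
          (Matrix.specialUnitaryGroup n ℂ)) = 0 := by
  have hN : (Fintype.card n : ℂ) ≠ 0 := Nat.cast_ne_zero.mpr Fintype.card_ne_zero
  set μ := Literature.MathematicalPhysics.QuantumFieldTheory.haarProbability
    (Matrix.specialUnitaryGroup n ℂ)
  set c : ℝ := β / Fintype.card n with hc
  -- the one-generator integrand `F Z U`
  set F : Matrix n n ℂ → Matrix.specialUnitaryGroup n ℂ → ℂ := fun Z U =>
    ((Z * Z * ((U : Matrix n n ℂ) * R)).trace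
      + (c : ℂ) * ((((Z * ((U : Matrix n n ℂ) * R)).trace).re : ℝ) : ℂ)
        * (Z * ((U : Matrix n n ℂ) * R)).trace)
    * ((Real.exp (c * (((U : Matrix n n ℂ) * R).trace).re) : ℝ) : ℂ) with hF
  have hA : Continuous fun U : Matrix.specialUnitaryGroup n ℂ => (U : Matrix n n ℂ) * R :=
    continuous_subtype_val.matrix_mul continuous_const
  have hint : ∀ Z, Integrable (F Z) μ := by
    intro Z
    refine integrable_of_continuous_SU (Continuous.mul (Continuous.add ?_ (Continuous.mul
      (continuous_const.mul (continuous_ofReal.comp (continuous_re.comp ?_))) ?_))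
      (continuous_ofReal.comp (Real.continuous_exp.comp (continuous_const.mul
        (continuous_re.comp hA.matrix_trace)))))
    · exact (continuous_const.matrix_mul hA).matrix_trace
    · exact (continuous_const.matrix_mul hA).matrix_trace
    · exact (continuous_const.matrix_mul hA).matrix_trace
  -- each generator direction integrates to zero, so the family sum of the integrals vanishes …
  have hsum : genSum (fun Z => ∫ U, F Z U ∂μ) = 0 :=
    genSum_eq_zero fun Z hZ hZ0 => specialUnitary_schwingerDyson_complex c R Z hZ hZ0
  -- … and equals the integral of the summed integrand, which is `−R(A) e` pointwise
  rw [← integral_genSum μ F hint] at hsum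
  have hpt : ∀ U : Matrix.specialUnitaryGroup n ℂ, genSum (fun Z => F Z U)
      = -(sdResidual β (Fintype.card n) ((U : Matrix n n ℂ) * R)
          * ((Real.exp (β / Fintype.card n * (((U : Matrix n n ℂ) * R).trace).re) : ℝ) : ℂ)) := by
    intro U
    simp only [hF]
    rw [genSum_mul_const, genSum_sd_integrand, sdResidual, hc]
    push_cast
    ring
  simp_rw [hpt, integral_neg, neg_eq_zero] at hsum
  exact hsum

end Summit.Ventures.LatticeQCDFlow.Exactness
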